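import Summits.AnomalousDissipation.AnomalousDissipation.Theorems.SawtoothPulseCascadeK1LocalisedCascadeTraceBoxTrapezoid

/-!
# K1loc — helper: MOMENT KERNELS OF THE BOX-PRODUCT TRAPEZOID («CT-GEO» 4/4: the sup-line inputs of the derivative traces)

Helper file of the prover lane on the crux `K1LocalisedCascade` (stmt-AnomalousDissipation-19491), route
`SawtoothPulseCascade` (S-D fibre ledger, corner-trace track; finding F-p1g9-1, memo v15).  The all-orders corner-trace bound
`…CornerTraceGeomSum.cornerTraceGeom_sum_sq_le` consumes the corner traces of `T_i = Σ_l χ_l l^i 𝓕b(l,n) e_l`, `i < p`; by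
`…TraceInput.sum_sq_trace_le_{h,v}fibre` (generic in the multiplier) these are bounded by `(K₁^{(i)}·‖b‖_∞)²` with
`K₁^{(i)} = ‖Σ_l χ_l l^i e^{2πily} e_{−l}‖_{L¹(𝕋)}`.  For the symmetric box-product trapezoid `χ_l = N(l)/R` of `…TraceKernels`
(`N(l) = #{(j,j′) ∈ [−L, L+R) × [0, R) : j − j′ = l}`) this file proves
  **`integral_norm_symmTrapezoid_momentKernel_le`**: `K₁^{(i)} ≤ (L+R−1)^i · √((2L+R)R)/R`
— `l^i = ((j−c) − (j′−c))^i` with the common centre `c = (R−1)/2`, binomial expansion, the kernel as `(1/R)Σ_q (i choose q)(−1)^{i−q}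
D_q·conj D′_{i−q}` with the MOMENT exponential sums `D_q = Σ_j (j−c)^q u_j`, `D′_r = Σ_{j′} (j′−c)^r u_{j′}`, Cauchy–Schwarz in `L²(𝕋)`
and the finite Parseval identity (`Σ_j (j−c)^{2q} ≤ (2L+R)(L+(R−1)/2)^{2q}`, `Σ_{j′}(j′−c)^{2r} ≤ R((R−1)/2)^{2r}`), and
`Σ_q (i choose q) a^q b^{i−q} = (a+b)^i = (L+R−1)^i` — no Bernstein inequality; plus the plug-ins
`sum_sq_trace_boxTrapezoid_moment_le_{v,h}`.  No definitions; nothing about the crux.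
[cite: Grafakos2014, Prop. 3.1.2 (5), Prop. 3.2.7 (3), §3.1.3] [problem: turb]
-/

-- `Summit.<Summit>.<Problem>`: single-conjunct summit, the duplicate namespace segment is deliberate.
set_option linter.dupNamespace false

noncomputable section

namespace Summit.AnomalousDissipation.AnomalousDissipation.Theorems.SawtoothPulseCascade.K1Window

open MeasureTheory Complex UnitAddTorus
open scoped Real ComplexConjugate
open Literature.Analysis.FunctionSpaces Literature.Analysis.FunctionSpaces.Torus

/-! ## §1 Cauchy–Schwarz for two continuous functions on `𝕋` -/

/-- `∫_𝕋 ‖D t‖‖D′ t‖ ≤ √(∫‖D‖²)·√(∫‖D′‖²)` for continuous `D, D′`. [folklore] -/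
theorem integral_norm_mul_norm_le_sqrt (D D' : UnitAddCircle → ℂ) (hD : Continuous D) (hD' : Continuous D') :
    ∫ t : UnitAddCircle, ‖D t‖ * ‖D' t‖ ≤
      Real.sqrt (∫ t : UnitAddCircle, ‖D t‖ ^ 2) * Real.sqrt (∫ t : UnitAddCircle, ‖D' t‖ ^ 2) := by
  have hφm : MemLp (fun t => ‖D t‖) 2 volume :=
    hD.norm.memLp_of_hasCompactSupport (HasCompactSupport.of_compactSpace _)
  have hψm : MemLp (fun t => ‖D' t‖) 2 volume :=
    hD'.norm.memLp_of_hasCompactSupport (HasCompactSupport.of_compactSpace _)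
  have h := integral_mul_le_Lp_mul_Lq_of_nonneg (μ := (volume : Measure UnitAddCircle)) Real.HolderConjugate.two_two
    (ae_of_all _ fun t => norm_nonneg (D t)) (ae_of_all _ fun t => norm_nonneg (D' t)) (by simpa using hφm) (by simpa using hψm)
  simpa only [Real.rpow_two, one_div, Real.sqrt_eq_rpow] using h

/-! ## §2 The moment kernel of the box product is a binomial sum of products of moment exponential sums -/

/-- **Moment product structure**: with `N(l)` the pair count of `[a, a+A) × [0, B)` and any complex centre `c`,
`Σ_{l∈(a−B,a+A)} N(l)·l^i·u_l = Σ_{q≤i} (i choose q)·(Σ_{j} (j−c)^q u_j)·conj(Σ_{j′} (j′−c)^{i−q} u_{j′})·(−1)^{i−q}`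
for REAL `c` (`u_j = e^{2πijy}e_{−j}`, `u_j·conj u_{j′} = u_{j−j′}`). [folklore] -/
theorem trapezoid_momentKernel_eq (a : ℤ) (A B : ℕ) (c y : ℝ) (i : ℕ) (t : UnitAddCircle) :
    ∑ l ∈ Finset.Ioo (a - B) (a + A),
        ((((Finset.Ico a (a + A)) ×ˢ (Finset.Ico (0 : ℤ) B)).filter (fun p : ℤ × ℤ => p.1 - p.2 = l)).card : ℂ) *
          ((l : ℂ) ^ i * (cexp (2 * π * I * l * y) * fourier (-l) t)) =
      ∑ q ∈ Finset.range (i + 1), ((i.choose q : ℕ) : ℂ) * (-1) ^ (i - q) *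
        ((∑ j ∈ Finset.Ico a (a + A), ((j : ℂ) - c) ^ q * (cexp (2 * π * I * j * y) * fourier (-j) t)) *
          conj (∑ j' ∈ Finset.Ico (0 : ℤ) B, ((j' : ℂ) - c) ^ (i - q) * (cexp (2 * π * I * j' * y) * fourier (-j') t))) := by
  classical
  -- right-hand side as a sum over pairs
  have hconj : ∀ r : ℕ, conj (∑ j' ∈ Finset.Ico (0 : ℤ) B, ((j' : ℂ) - c) ^ r * (cexp (2 * π * I * j' * y) * fourier (-j') t)) =
      ∑ j' ∈ Finset.Ico (0 : ℤ) B, ((j' : ℂ) - c) ^ r * conj (cexp (2 * π * I * j' * y) * fourier (-j') t) := by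
    intro r
    rw [map_sum]
    refine Finset.sum_congr rfl fun j' _ => ?_
    rw [map_mul, map_pow, map_sub, Complex.conj_ofReal, map_intCast]
  simp_rw [hconj]
  have hrhs : ∑ q ∈ Finset.range (i + 1), ((i.choose q : ℕ) : ℂ) * (-1) ^ (i - q) *
      ((∑ j ∈ Finset.Ico a (a + A), ((j : ℂ) - c) ^ q * (cexp (2 * π * I * j * y) * fourier (-j) t)) *
        ∑ j' ∈ Finset.Ico (0 : ℤ) B, ((j' : ℂ) - c) ^ (i - q) * conj (cexp (2 * π * I * j' * y) * fourier (-j') t)) =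
      ∑ p ∈ (Finset.Ico a (a + A)) ×ˢ (Finset.Ico (0 : ℤ) B),
        ((p.1 : ℂ) - p.2) ^ i * (cexp (2 * π * I * ((p.1 - p.2 : ℤ) : ℂ) * y) * fourier (-(p.1 - p.2)) t) := by
    -- expand the products of sums, swap, and use the binomial theorem pairwise
    have step : ∀ q ∈ Finset.range (i + 1), ((i.choose q : ℕ) : ℂ) * (-1) ^ (i - q) *
        ((∑ j ∈ Finset.Ico a (a + A), ((j : ℂ) - c) ^ q * (cexp (2 * π * I * j * y) * fourier (-j) t)) *
          ∑ j' ∈ Finset.Ico (0 : ℤ) B, ((j' : ℂ) - c) ^ (i - q) * conj (cexp (2 * π * I * j' * y) * fourier (-j') t)) =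
        ∑ p ∈ (Finset.Ico a (a + A)) ×ˢ (Finset.Ico (0 : ℤ) B), ((i.choose q : ℕ) : ℂ) * (-1) ^ (i - q) *
          (((p.1 : ℂ) - c) ^ q * ((p.2 : ℂ) - c) ^ (i - q)) *
            ((cexp (2 * π * I * p.1 * y) * fourier (-p.1) t) * conj (cexp (2 * π * I * p.2 * y) * fourier (-p.2) t)) := by
      intro q _
      rw [Finset.sum_mul_sum, ← Finset.sum_product', Finset.mul_sum]
      refine Finset.sum_congr rfl fun p _ => ?_
      ring
    rw [Finset.sum_congr rfl step, Finset.sum_comm]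
    refine Finset.sum_congr rfl fun p _ => ?_
    rw [← Finset.sum_mul, expChar_mul_conj]
    congr 1
    -- binomial theorem: `((j−c) + (c−j′))^i`
    have hb := add_pow ((p.1 : ℂ) - c) ((c : ℂ) - p.2) i
    have e0 : ((p.1 : ℂ) - c) + ((c : ℂ) - p.2) = (p.1 : ℂ) - p.2 := by ring
    rw [e0] at hb
    rw [hb]
    refine Finset.sum_congr rfl fun q hq => ?_
    have hqi : q ≤ i := Nat.lt_succ_iff.mp (Finset.mem_range.mp hq)
    have e1 : ((c : ℂ) - p.2) ^ (i - q) = (-1) ^ (i - q) * ((p.2 : ℂ) - c) ^ (i - q) := by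
      rw [← mul_pow]; congr 1; ring
    rw [e1]; ring
  rw [hrhs]
  -- left-hand side: group the pairs by `j − j′`
  have hmaps : ∀ p ∈ (Finset.Ico a (a + A)) ×ˢ (Finset.Ico (0 : ℤ) B), p.1 - p.2 ∈ Finset.Ioo (a - B) (a + A) := by
    rintro ⟨j, j'⟩ hp
    simp only [Finset.mem_product, Finset.mem_Ico] at hp
    simp only [Finset.mem_Ioo]
    omega
  rw [← Finset.sum_fiberwise_of_maps_to hmaps]
  refine Finset.sum_congr rfl fun l _ => ?_
  rw [Finset.sum_filter]
  have hterm : ∀ p ∈ (Finset.Ico a (a + A)) ×ˢ (Finset.Ico (0 : ℤ) B),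
      (if p.1 - p.2 = l then ((p.1 : ℂ) - p.2) ^ i * (cexp (2 * π * I * ((p.1 - p.2 : ℤ) : ℂ) * y) * fourier (-(p.1 - p.2)) t)
        else 0) = if p.1 - p.2 = l then (l : ℂ) ^ i * (cexp (2 * π * I * l * y) * fourier (-l) t) else 0 := by
    rintro ⟨j, j'⟩ _
    split_ifs with h
    · rw [← h]; push_cast; rfl
    · rfl
  rw [Finset.sum_congr rfl hterm, ← Finset.sum_filter, Finset.sum_const, nsmul_eq_mul]

/-! ## §3 The `L¹` bound of the moment kernel -/

/-- Energy of a moment exponential sum: `∫|Σ_{j∈J} (j−c)^q u_j|² = Σ_{j∈J} |j−c|^{2q} ≤ #J·m^{2q}` if `|j − c| ≤ m` on `J`. [folklore] -/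
theorem integral_norm_sq_momentSum_le (J : Finset ℤ) (c y : ℝ) (q : ℕ) {m : ℝ} (hm : ∀ j ∈ J, |(j : ℝ) - c| ≤ m) :
    ∫ t : UnitAddCircle, ‖∑ j ∈ J, ((j : ℂ) - c) ^ q * (cexp (2 * π * I * j * y) * fourier (-j) t)‖ ^ 2 ≤
      (J.card : ℝ) * m ^ (2 * q) := by
  have h := integral_norm_sq_trigSum_eq J (fun j => ((j : ℂ) - c) ^ q * cexp (2 * π * I * j * y))
  simp only [← mul_assoc] at h ⊢
  rw [h]
  calc ∑ n ∈ J, ‖((n : ℂ) - c) ^ q * cexp (2 * π * I * n * y)‖ ^ 2 ≤ ∑ n ∈ J, m ^ (2 * q) := by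
        refine Finset.sum_le_sum fun j hj => ?_
        have e1 : ‖cexp (2 * π * I * j * y)‖ = 1 := by
          rw [show (2 * π * I * j * y : ℂ) = ((2 * π * j * y : ℝ) : ℂ) * I by push_cast; ring, Complex.norm_exp_ofReal_mul_I]
        have e2 : ‖((j : ℂ) - c)‖ = |(j : ℝ) - c| := by
          rw [show ((j : ℂ) - c) = (((j : ℝ) - c : ℝ) : ℂ) by push_cast; rfl, Complex.norm_real, Real.norm_eq_abs]
        rw [norm_mul, e1, mul_one, norm_pow, e2, ← pow_mul, mul_comm q 2]
        exact pow_le_pow_left₀ (abs_nonneg _) (hm j hj) _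
    _ = (J.card : ℝ) * m ^ (2 * q) := by rw [Finset.sum_const, nsmul_eq_mul]

set_option maxHeartbeats 800000 in
/-- **`L¹` NORM OF THE MOMENT KERNEL OF THE SYMMETRIC BOX TRAPEZOID**: for `R ≥ 1`, every `i` and every `y ∈ ℝ`,
`∫_𝕋 |Σ_l (N(l)/R)·l^i·e^{2πily} e_{−l}(t)| dt ≤ (L+R−1)^i·√((2L+R)R)/R`. [cite: Grafakos2014, Prop. 3.2.7 (3)] -/
theorem integral_norm_symmTrapezoid_momentKernel_le (L : ℕ) {R : ℕ} (hR : 0 < R) (i : ℕ) (y : ℝ) :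
    ∫ t : UnitAddCircle, ‖∑ l ∈ Finset.Ioo (-(L : ℤ) - R) (-(L : ℤ) + (2 * L + R : ℕ)),
        (((((Finset.Ico (-(L : ℤ)) (-(L : ℤ) + (2 * L + R : ℕ))) ×ˢ (Finset.Ico (0 : ℤ) R)).filter
            (fun p : ℤ × ℤ => p.1 - p.2 = l)).card : ℂ) / R) * (l : ℂ) ^ i *
          cexp (2 * π * I * l * y) * fourier (-l) t‖ ≤
      ((L : ℝ) + R - 1) ^ i * (Real.sqrt ((2 * L + R : ℕ) * R) / R) := by
  classical
  have hRr : (0 : ℝ) < R := by exact_mod_cast hR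
  set a : ℤ := -(L : ℤ) with ha
  set A : ℕ := 2 * L + R with hA
  set c : ℝ := ((R : ℝ) - 1) / 2 with hc
  set a₁ : ℝ := (L : ℝ) + ((R : ℝ) - 1) / 2 with ha₁
  set b₁ : ℝ := ((R : ℝ) - 1) / 2 with hb₁
  have hb₁0 : 0 ≤ b₁ := by
    rw [hb₁]; have : (1 : ℝ) ≤ R := by exact_mod_cast hR
    linarith
  have ha₁0 : 0 ≤ a₁ := by rw [ha₁]; positivity
  -- the moment exponential sums
  set D : ℕ → UnitAddCircle → ℂ := fun q t =>
    ∑ j ∈ Finset.Ico a (a + A), ((j : ℂ) - c) ^ q * (cexp (2 * π * I * j * y) * fourier (-j) t) with hD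
  set D' : ℕ → UnitAddCircle → ℂ := fun r t =>
    ∑ j' ∈ Finset.Ico (0 : ℤ) R, ((j' : ℂ) - c) ^ r * (cexp (2 * π * I * j' * y) * fourier (-j') t) with hD'
  have hDc : ∀ q, Continuous (D q) := fun q =>
    continuous_finsetSum _ fun n _ => continuous_const.mul (continuous_const.mul (fourier (-n)).continuous)
  have hD'c : ∀ r, Continuous (D' r) := fun r =>
    continuous_finsetSum _ fun n _ => continuous_const.mul (continuous_const.mul (fourier (-n)).continuous)
  -- the integrand
  have hpt : ∀ t : UnitAddCircle, ‖∑ l ∈ Finset.Ioo (-(L : ℤ) - R) (-(L : ℤ) + (2 * L + R : ℕ)),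
      (((((Finset.Ico (-(L : ℤ)) (-(L : ℤ) + (2 * L + R : ℕ))) ×ˢ (Finset.Ico (0 : ℤ) R)).filter
          (fun p : ℤ × ℤ => p.1 - p.2 = l)).card : ℂ) / R) * (l : ℂ) ^ i *
        cexp (2 * π * I * l * y) * fourier (-l) t‖ ≤
      (1 / R) * ∑ q ∈ Finset.range (i + 1), (i.choose q : ℝ) * (‖D q t‖ * ‖D' (i - q) t‖) := by
    intro t
    have e1 : ∑ l ∈ Finset.Ioo (-(L : ℤ) - R) (-(L : ℤ) + (2 * L + R : ℕ)),
        (((((Finset.Ico (-(L : ℤ)) (-(L : ℤ) + (2 * L + R : ℕ))) ×ˢ (Finset.Ico (0 : ℤ) R)).filter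
            (fun p : ℤ × ℤ => p.1 - p.2 = l)).card : ℂ) / R) * (l : ℂ) ^ i *
          cexp (2 * π * I * l * y) * fourier (-l) t =
        (1 / (R : ℂ)) * ∑ l ∈ Finset.Ioo (a - R) (a + A),
          ((((Finset.Ico a (a + A)) ×ˢ (Finset.Ico (0 : ℤ) R)).filter (fun p : ℤ × ℤ => p.1 - p.2 = l)).card : ℂ) *
            ((l : ℂ) ^ i * (cexp (2 * π * I * l * y) * fourier (-l) t)) := by
      rw [Finset.mul_sum]
      refine Finset.sum_congr rfl fun l _ => ?_
      ring
    rw [e1, trapezoid_momentKernel_eq a A R c y i t, norm_mul, norm_div, norm_one, Complex.norm_natCast]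
    refine mul_le_mul_of_nonneg_left ((norm_sum_le _ _).trans (Finset.sum_le_sum fun q _ => ?_)) (by positivity)
    rw [norm_mul, norm_mul, norm_mul, norm_pow, norm_neg, norm_one, one_pow, mul_one, Complex.norm_natCast,
      RCLike.norm_conj]
  -- integrate
  have hIq : ∀ q, Integrable (fun t : UnitAddCircle => (i.choose q : ℝ) * (‖D q t‖ * ‖D' (i - q) t‖)) volume := fun q =>
    (continuous_const.mul ((hDc q).norm.mul (hD'c (i - q)).norm)).integrable_of_hasCompactSupport
      (HasCompactSupport.of_compactSpace _)
  have hInt : Integrable (fun t : UnitAddCircle => (1 / (R : ℝ)) * ∑ q ∈ Finset.range (i + 1),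
      (i.choose q : ℝ) * (‖D q t‖ * ‖D' (i - q) t‖)) volume :=
    (integrable_finsetSum _ fun q _ => hIq q).const_mul _
  have hInt0 : Integrable (fun t : UnitAddCircle => ‖∑ l ∈ Finset.Ioo (-(L : ℤ) - R) (-(L : ℤ) + (2 * L + R : ℕ)),
      (((((Finset.Ico (-(L : ℤ)) (-(L : ℤ) + (2 * L + R : ℕ))) ×ˢ (Finset.Ico (0 : ℤ) R)).filter
          (fun p : ℤ × ℤ => p.1 - p.2 = l)).card : ℂ) / R) * (l : ℂ) ^ i *
        cexp (2 * π * I * l * y) * fourier (-l) t‖) volume := by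
    refine (Continuous.integrable_of_hasCompactSupport ?_ (HasCompactSupport.of_compactSpace _))
    exact (continuous_finsetSum _ fun l _ => continuous_const.mul (fourier (-l)).continuous).norm
  refine (integral_mono hInt0 hInt hpt).trans ?_
  rw [integral_const_mul, integral_finsetSum (Finset.range (i + 1))
    (f := fun q t => (i.choose q : ℝ) * (‖D q t‖ * ‖D' (i - q) t‖)) (fun q _ => hIq q)]
  -- each term
  have hcard1 : ((Finset.Ico a (a + A)).card : ℝ) = (2 * L + R : ℕ) := by
    rw [Int.card_Ico]; congr 1; rw [hA]; omega
  have hcard2 : ((Finset.Ico (0 : ℤ) R).card : ℝ) = R := by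
    rw [Int.card_Ico, sub_zero, Int.toNat_natCast]
  have hm1 : ∀ j ∈ Finset.Ico a (a + A), |(j : ℝ) - c| ≤ a₁ := by
    intro j hj
    obtain ⟨h1, h2⟩ := Finset.mem_Ico.mp hj
    have h1' : (-(L : ℝ)) ≤ j := by rw [ha] at h1; exact_mod_cast h1
    have h2' : (j : ℝ) + 1 ≤ -(L : ℝ) + (2 * L + R : ℕ) := by
      rw [ha, hA] at h2; have : j + 1 ≤ -(L : ℤ) + (2 * L + R : ℕ) := h2; exact_mod_cast this
    push_cast at h2'
    rw [hc, ha₁, abs_le]; constructor <;> linarith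
  have hm2 : ∀ j' ∈ Finset.Ico (0 : ℤ) R, |(j' : ℝ) - c| ≤ b₁ := by
    intro j' hj'
    obtain ⟨h1, h2⟩ := Finset.mem_Ico.mp hj'
    have h1' : (0 : ℝ) ≤ j' := by exact_mod_cast h1
    have h2' : (j' : ℝ) + 1 ≤ R := by have : j' + 1 ≤ (R : ℤ) := h2; exact_mod_cast this
    rw [hc, hb₁, abs_le]; constructor <;> linarith
  have hterm : ∀ q ∈ Finset.range (i + 1), ∫ t : UnitAddCircle, (i.choose q : ℝ) * (‖D q t‖ * ‖D' (i - q) t‖) ≤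
      (i.choose q : ℝ) * (a₁ ^ q * b₁ ^ (i - q) * Real.sqrt ((2 * L + R : ℕ) * R)) := by
    intro q _
    rw [integral_const_mul]
    refine mul_le_mul_of_nonneg_left ?_ (by positivity)
    refine (integral_norm_mul_norm_le_sqrt _ _ (hDc q) (hD'c (i - q))).trans ?_
    have e1 : ∫ t : UnitAddCircle, ‖D q t‖ ^ 2 ≤ ((2 * L + R : ℕ) : ℝ) * a₁ ^ (2 * q) := by
      have := integral_norm_sq_momentSum_le (Finset.Ico a (a + A)) c y q hm1
      rwa [hcard1] at this
    have e2 : ∫ t : UnitAddCircle, ‖D' (i - q) t‖ ^ 2 ≤ (R : ℝ) * b₁ ^ (2 * (i - q)) := by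
      have := integral_norm_sq_momentSum_le (Finset.Ico (0 : ℤ) R) c y (i - q) hm2
      rwa [hcard2] at this
    calc Real.sqrt (∫ t : UnitAddCircle, ‖D q t‖ ^ 2) * Real.sqrt (∫ t : UnitAddCircle, ‖D' (i - q) t‖ ^ 2)
        ≤ Real.sqrt (((2 * L + R : ℕ) : ℝ) * a₁ ^ (2 * q)) * Real.sqrt ((R : ℝ) * b₁ ^ (2 * (i - q))) := by
          gcongr
      _ = a₁ ^ q * b₁ ^ (i - q) * Real.sqrt ((2 * L + R : ℕ) * R) := by
          rw [pow_mul', pow_mul', Real.sqrt_mul (by positivity), Real.sqrt_mul (by positivity),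
            Real.sqrt_sq (by positivity), Real.sqrt_sq (by positivity), Real.sqrt_mul (by positivity)]
          ring
  refine (mul_le_mul_of_nonneg_left (Finset.sum_le_sum hterm) (by positivity)).trans ?_
  -- the binomial theorem once more
  have hbin : ∑ q ∈ Finset.range (i + 1), (i.choose q : ℝ) * (a₁ ^ q * b₁ ^ (i - q) * Real.sqrt ((2 * L + R : ℕ) * R)) =
      (a₁ + b₁) ^ i * Real.sqrt ((2 * L + R : ℕ) * R) := by
    rw [add_pow, Finset.sum_mul]
    refine Finset.sum_congr rfl fun q _ => ?_
    ring
  rw [hbin]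
  have e3 : a₁ + b₁ = (L : ℝ) + R - 1 := by rw [ha₁, hb₁]; ring
  rw [e3]
  exact le_of_eq (by ring)

/-! ## §4 Plugged into the input-free trace bound (sign-split, real input) -/

/-- **Sign split from a norm symmetry**: if `‖T(−n)‖ = ‖T n‖` on a sign-symmetric `F` and `Σ_F ‖T‖² ≤ Θ`, then both the positive and
the negative half carry at most `Θ/2`. [folklore] -/
theorem sum_filter_sign_le_half_of_norm (T : ℤ → ℂ) (hT : ∀ n, ‖T (-n)‖ = ‖T n‖) (F : Finset ℤ)
    (hF : ∀ n ∈ F, -n ∈ F) {Θ : ℝ} (hΘ : ∑ n ∈ F, ‖T n‖ ^ 2 ≤ Θ) :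
    ∑ n ∈ F.filter (fun n => 0 < n), ‖T n‖ ^ 2 ≤ Θ / 2 ∧ ∑ n ∈ F.filter (fun n => n < 0), ‖T n‖ ^ 2 ≤ Θ / 2 := by
  classical
  have heq : ∑ n ∈ F.filter (fun n => 0 < n), ‖T n‖ ^ 2 = ∑ n ∈ F.filter (fun n => n < 0), ‖T n‖ ^ 2 := by
    have himg : F.filter (fun n => n < 0) = (F.filter (fun n => 0 < n)).image (fun n => -n) := by
      ext n
      simp only [Finset.mem_filter, Finset.mem_image]
      constructor
      · rintro ⟨h1, h2⟩; exact ⟨-n, ⟨hF n h1, by omega⟩, by ring⟩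
      · rintro ⟨m, ⟨h1, h2⟩, rfl⟩; exact ⟨hF m h1, by omega⟩
    rw [himg, Finset.sum_image (fun a _ b _ h => neg_injective h)]
    exact Finset.sum_congr rfl fun n _ => by rw [hT]
  have hle : ∑ n ∈ F.filter (fun n => 0 < n), ‖T n‖ ^ 2 + ∑ n ∈ F.filter (fun n => n < 0), ‖T n‖ ^ 2 ≤ Θ := by
    have hdisj : Disjoint (F.filter (fun n => 0 < n)) (F.filter (fun n => n < 0)) := by
      rw [Finset.disjoint_filter]; intro n _ h1; omega
    rw [← Finset.sum_union hdisj]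
    refine le_trans (Finset.sum_le_sum_of_subset_of_nonneg (Finset.union_subset (Finset.filter_subset _ _)
      (Finset.filter_subset _ _)) fun _ _ _ => sq_nonneg _) hΘ
  constructor <;> linarith

/-- For a real input `v` and the (even, real) box trapezoid, the moment traces have the norm symmetry `‖T_i(−n)‖ = ‖T_i(n)‖`
(V indexing: `T_i(n) = Σ_l χ_l l^i 𝓕v(l,n) e^{2πily}`). [folklore] -/
theorem norm_momentTrace_neg_v (v : UnitAddTorus (Fin 2) → ℝ) (L R : ℕ) (i : ℕ) (n : ℤ) (y : ℝ) :
    ‖∑ l ∈ Finset.Icc (-((L + R : ℕ) : ℤ)) (L + R : ℕ),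
      (((((Finset.Ico (-(L : ℤ)) (-(L : ℤ) + (2 * L + R : ℕ))) ×ˢ (Finset.Ico (0 : ℤ) R)).filter
        (fun p : ℤ × ℤ => p.1 - p.2 = l)).card : ℂ) / R) * (l : ℂ) ^ i * mFourierCoeff (fun x => (v x : ℂ)) ![l, -n] *
          cexp (2 * π * I * l * y)‖ =
    ‖∑ l ∈ Finset.Icc (-((L + R : ℕ) : ℤ)) (L + R : ℕ),
      (((((Finset.Ico (-(L : ℤ)) (-(L : ℤ) + (2 * L + R : ℕ))) ×ˢ (Finset.Ico (0 : ℤ) R)).filter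
        (fun p : ℤ × ℤ => p.1 - p.2 = l)).card : ℂ) / R) * (l : ℂ) ^ i * mFourierCoeff (fun x => (v x : ℂ)) ![l, n] *
          cexp (2 * π * I * l * y)‖ := by
  classical
  set χ : ℤ → ℂ := fun l => (((((Finset.Ico (-(L : ℤ)) (-(L : ℤ) + (2 * L + R : ℕ))) ×ˢ (Finset.Ico (0 : ℤ) R)).filter
        (fun p : ℤ × ℤ => p.1 - p.2 = l)).card : ℂ) / R) with hχ
  have hχe : ∀ l, χ (-l) = χ l := fun l => by
    simp only [hχ]; rw [boxTrapezoid_even]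
  have hχr : ∀ l, conj (χ l) = χ l := fun l => by
    simp only [hχ, map_div₀, map_natCast]
  -- `T_i(−n) = (−1)^i · conj(T_i(n))` after the substitution `l ↦ −l`
  set S : Finset ℤ := Finset.Icc (-((L + R : ℕ) : ℤ)) (L + R : ℕ) with hS
  have himg : S.image (fun l => -l) = S := by
    ext l; simp only [hS, Finset.mem_image, Finset.mem_Icc]
    constructor
    · rintro ⟨m, ⟨h1, h2⟩, rfl⟩; omega
    · rintro ⟨h1, h2⟩; exact ⟨-l, ⟨by omega, by omega⟩, by ring⟩
  have key : ∀ m : ℤ, χ (-m) * ((-m : ℤ) : ℂ) ^ i * mFourierCoeff (fun x => (v x : ℂ)) ![-m, -n] *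
      cexp (2 * π * I * ((-m : ℤ) : ℂ) * y) =
      (-1) ^ i * conj (χ m * (m : ℂ) ^ i * mFourierCoeff (fun x => (v x : ℂ)) ![m, n] * cexp (2 * π * I * m * y)) := by
    intro m
    have hb : mFourierCoeff (fun x => (v x : ℂ)) ![-m, -n] = conj (mFourierCoeff (fun x => (v x : ℂ)) ![m, n]) := by
      rw [← mFourierCoeff_ofReal_neg]
      congr 1
      ext j; fin_cases j <;> simp
    have he : cexp (2 * π * I * ((-m : ℤ) : ℂ) * y) = conj (cexp (2 * π * I * m * y)) := by
      rw [← Complex.exp_conj]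
      congr 1
      simp only [map_mul, map_ofNat, Complex.conj_ofReal, Complex.conj_I, map_intCast]
      push_cast; ring
    rw [hχe, hb, he, map_mul, map_mul, map_mul, hχr, map_pow, map_intCast]
    push_cast
    rw [neg_pow]
    ring
  have hsum : ∑ l ∈ S, χ l * (l : ℂ) ^ i * mFourierCoeff (fun x => (v x : ℂ)) ![l, -n] * cexp (2 * π * I * l * y) =
      (-1) ^ i * conj (∑ l ∈ S, χ l * (l : ℂ) ^ i * mFourierCoeff (fun x => (v x : ℂ)) ![l, n] * cexp (2 * π * I * l * y)) := by
    rw [map_sum, Finset.mul_sum]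
    conv_lhs => rw [← himg]
    rw [Finset.sum_image (fun a _ b _ h => neg_injective h)]
    exact Finset.sum_congr rfl fun m _ => key m
  simp only [hχ, hS] at hsum ⊢
  rw [hsum, norm_mul, norm_pow, norm_neg, norm_one, one_pow, one_mul, RCLike.norm_conj]

/-- **Sign-split moment trace bounds for the box trapezoid, V indexing**: for a real continuous input `|v| ≤ B`, a sign-symmetric
fibre set `F`, every `i`, `y`: both halves `≤ ((L+R−1)^i·√((2L+R)R)/R·B)²/2`. [cite: Grafakos2014, Prop. 3.1.2 (5), Prop. 3.2.7 (3)] -/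
theorem sum_sq_trace_boxTrapezoid_moment_sign_le_v {v : UnitAddTorus (Fin 2) → ℝ} (hv : Continuous v) {B : ℝ}
    (hB : ∀ x, |v x| ≤ B) (L : ℕ) {R : ℕ} (hR : 0 < R) (F : Finset ℤ) (hF : ∀ n ∈ F, -n ∈ F) (i : ℕ) (y : ℝ) :
    ∑ n ∈ F.filter (fun n => 0 < n), ‖∑ l ∈ Finset.Icc (-((L + R : ℕ) : ℤ)) (L + R : ℕ),
      (((((Finset.Ico (-(L : ℤ)) (-(L : ℤ) + (2 * L + R : ℕ))) ×ˢ (Finset.Ico (0 : ℤ) R)).filter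
        (fun p : ℤ × ℤ => p.1 - p.2 = l)).card : ℂ) / R) * (l : ℂ) ^ i * mFourierCoeff (fun x => (v x : ℂ)) ![l, n] *
          cexp (2 * π * I * l * y)‖ ^ 2 ≤ (((L : ℝ) + R - 1) ^ i * (Real.sqrt ((2 * L + R : ℕ) * R) / R) * B) ^ 2 / 2 ∧
    ∑ n ∈ F.filter (fun n => n < 0), ‖∑ l ∈ Finset.Icc (-((L + R : ℕ) : ℤ)) (L + R : ℕ),
      (((((Finset.Ico (-(L : ℤ)) (-(L : ℤ) + (2 * L + R : ℕ))) ×ˢ (Finset.Ico (0 : ℤ) R)).filter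
        (fun p : ℤ × ℤ => p.1 - p.2 = l)).card : ℂ) / R) * (l : ℂ) ^ i * mFourierCoeff (fun x => (v x : ℂ)) ![l, n] *
          cexp (2 * π * I * l * y)‖ ^ 2 ≤ (((L : ℝ) + R - 1) ^ i * (Real.sqrt ((2 * L + R : ℕ) * R) / R) * B) ^ 2 / 2 := by
  classical
  have hvc : Continuous fun x => (v x : ℂ) := Complex.continuous_ofReal.comp hv
  have hvi : Integrable (fun x => (v x : ℂ)) volume := hvc.integrable_of_hasCompactSupport (HasCompactSupport.of_compactSpace _)
  have hB' : ∀ x, ‖(v x : ℂ)‖ ≤ B := fun x => by rw [Complex.norm_real, Real.norm_eq_abs]; exact hB x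
  -- the full trace bound through `…TraceInput` with the multiplier `χ_l l^i`, over the open interval
  have hfull := sum_sq_trace_le_vfibre hvi hB' (fun l => (((((Finset.Ico (-(L : ℤ)) (-(L : ℤ) + (2 * L + R : ℕ))) ×ˢ
      (Finset.Ico (0 : ℤ) R)).filter (fun p : ℤ × ℤ => p.1 - p.2 = l)).card : ℂ) / R) * (l : ℂ) ^ i)
    (Finset.Ioo (-(L : ℤ) - R) (-(L : ℤ) + (2 * L + R : ℕ))) F y (integral_norm_symmTrapezoid_momentKernel_le L hR i y)
  -- rewrite the source sums over `[−(L+R), L+R]`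
  have hIcc : ∀ n : ℤ, ∑ l ∈ Finset.Icc (-((L + R : ℕ) : ℤ)) (L + R : ℕ),
      (((((Finset.Ico (-(L : ℤ)) (-(L : ℤ) + (2 * L + R : ℕ))) ×ˢ (Finset.Ico (0 : ℤ) R)).filter
        (fun p : ℤ × ℤ => p.1 - p.2 = l)).card : ℂ) / R) * (l : ℂ) ^ i * mFourierCoeff (fun x => (v x : ℂ)) ![l, n] *
          cexp (2 * π * I * l * y) =
      ∑ l ∈ Finset.Ioo (-(L : ℤ) - R) (-(L : ℤ) + (2 * L + R : ℕ)),
        (((((Finset.Ico (-(L : ℤ)) (-(L : ℤ) + (2 * L + R : ℕ))) ×ˢ (Finset.Ico (0 : ℤ) R)).filter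
          (fun p : ℤ × ℤ => p.1 - p.2 = l)).card : ℂ) / R) * (l : ℂ) ^ i * mFourierCoeff (fun x => (v x : ℂ)) ![l, n] *
            cexp (2 * π * I * l * y) := by
    intro n
    have h := sum_Icc_boxTrapezoid_eq_sum_Ioo L R (fun l => (l : ℂ) ^ i * mFourierCoeff (fun x => (v x : ℂ)) ![l, n])
      (fun l => cexp (2 * π * I * l * y))
    simp only [← mul_assoc] at h
    exact h
  refine sum_filter_sign_le_half_of_norm _ (fun n => norm_momentTrace_neg_v v L R i n y) F hF ?_
  simp_rw [hIcc]
  simpa only [mul_assoc] using hfull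

end Summit.AnomalousDissipation.AnomalousDissipation.Theorems.SawtoothPulseCascade.K1Window
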